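/-
Copyright: formalisation for the LaceExpansionHighD cell (what-if lane, kernel instance at `d := 10`, input certificate).
Source formalised: R. Fitzner, R. van der Hofstad, *Mean-field behavior for nearest-neighbor percolation in d > 10*
(the NoBLE analysis), §5.1.2 (5.14), (5.16) p. 1092, Lemma 5.1 p. 1093, §5.3.3 p. 1098.
-/
import Literature.Probability.FitznerVanDerHofstad2017.SrwWPatternFarSqrtD10
import Literature.Probability.FitznerVanDerHofstad2017.SrwWPatternRefFarD10
import HarnessLib

/-!
# Best certified far cap of the orbit-averaged two-leg integral at `d := 10` (input certificate)

The two LANDED far-cap tables of the collision-pattern route — `WPatD10Far.farFQ` (pattern law × the monotone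
lookup over the 27 landed shell-class tables, `SrwWPatternFarSqrtD10`) and `WPatD10Ref.farRQ` (pattern law × the
monotone lookup over the positionally certified reference table, `SrwWPatternRefFarD10`) — both certify
`K_{1,κ}(vecOfParts 10 p; 10) ≤ F` for the tabulated `(κ, p)` (`κ ∈ {24,…,32}`, the 23 far types with at most four
non-zero coordinates).  This module only takes their minimum BY NAME: `farBestQ κ p` and the two consumer
theorems `srwK_le_of_farBestQ` / `srwK_canonSite_le_of_farBestQ`.  No new table, no new hypothesis; a kernel
instance at `d := 10` of the what-if / input-certification lane (the record certificate and its tuples are not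
touched).  Here `K_{n,κ}(x) = srwK d n κ x` is the orbit-averaged Cauchy–Schwarz leg of (5.16) p. 1092.
-/

set_option autoImplicit false

namespace Literature.Probability.FitznerVanDerHofstad2017

namespace WPatD10Best

open WPatD10 WPatD10Far WPatD10Ref

/-- Minimum of two optional rational caps (`none` = no cap on that side).
[cite: FitznerVanDerHofstad2016NoBLE, §5.1.2 (5.16) p. 1092] -/
def optMinQ : Option ℚ → Option ℚ → Option ℚ
  | some a, some b => some (min a b)
  | some a, none => some a
  | none, some b => some b
  | none, none => none

/-- **Best landed far cap** `farBestQ κ p = min (farFQ κ p) (farRQ κ p)` (whichever sides are tabulated).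
[cite: FitznerVanDerHofstad2016NoBLE, §5.1.2 (5.16) p. 1092, Lemma 5.1 p. 1093] -/
def farBestQ (κ : ℕ) (p : List ℕ) : Option ℚ := optMinQ (farFQ κ p) (farRQ κ p)

/-- **`K_{1,κ}(vecOfParts 10 p; 10) ≤ F` whenever `farBestQ κ p = some F`** (input certificate of the what-if lane:
the minimum of the two landed certified caps `srwK_le_of_farFQ` / `srwK_le_of_farRQ`).
[cite: FitznerVanDerHofstad2016NoBLE, §5.1.2 (5.16) p. 1092, Lemma 5.1 p. 1093] -/
theorem srwK_le_of_farBestQ {κ : ℕ} {p : List ℕ} {F : ℚ} (h : farBestQ κ p = some F) :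
    srwK 10 1 κ (vecOfParts 10 p) ≤ ((F : ℚ) : ℝ) := by
  cases hF : farFQ κ p with
  | none =>
    cases hR : farRQ κ p with
    | none => simp [farBestQ, optMinQ, hF, hR] at h
    | some b =>
      simp only [farBestQ, optMinQ, hF, hR, Option.some.injEq] at h
      subst h
      exact srwK_le_of_farRQ hR
  | some a =>
    cases hR : farRQ κ p with
    | none =>
      simp only [farBestQ, optMinQ, hF, hR, Option.some.injEq] at h
      subst h
      exact srwK_le_of_farFQ hF
    | some b =>
      simp only [farBestQ, optMinQ, hF, hR, Option.some.injEq] at h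
      subst h
      rcases min_choice a b with hm | hm <;> rw [hm]
      · exact srwK_le_of_farFQ hF
      · exact srwK_le_of_farRQ hR

/-- **`K_{1,κ}(canonSite 10 l; 10) ≤ F` whenever `farBestQ κ (partsOf l) = some F`** — the consumer form at the
canonical live end-point of the class with multiplicity list `l` (input certificate of the what-if lane).
[cite: FitznerVanDerHofstad2016NoBLE, §5.1.2 (5.16) p. 1092, §5.3.3 p. 1098] -/
theorem srwK_canonSite_le_of_farBestQ {κ : ℕ} {l : List ℕ} {F : ℚ} (h : farBestQ κ (partsOf l) = some F) :
    srwK 10 1 κ (canonSite 10 l) ≤ ((F : ℚ) : ℝ) := by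
  rw [canonSite_eq_vecOfParts]; exact srwK_le_of_farBestQ h

/-- The best cap is never above the shell-class-table cap. [cite: FitznerVanDerHofstad2016NoBLE, §5.1.2 (5.16) p. 1092] -/
theorem farBestQ_le_farFQ {κ : ℕ} {p : List ℕ} {F G : ℚ} (h : farBestQ κ p = some F) (hG : farFQ κ p = some G) :
    F ≤ G := by
  cases hR : farRQ κ p with
  | none => simp only [farBestQ, optMinQ, hG, hR, Option.some.injEq] at h; rw [← h]
  | some b => simp only [farBestQ, optMinQ, hG, hR, Option.some.injEq] at h; rw [← h]; exact min_le_left _ _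

/-- The best cap is never above the reference-table cap. [cite: FitznerVanDerHofstad2016NoBLE, §5.1.2 (5.16) p. 1092] -/
theorem farBestQ_le_farRQ {κ : ℕ} {p : List ℕ} {F G : ℚ} (h : farBestQ κ p = some F) (hG : farRQ κ p = some G) :
    F ≤ G := by
  cases hF : farFQ κ p with
  | none => simp only [farBestQ, optMinQ, hF, hG, Option.some.injEq] at h; rw [← h]
  | some a => simp only [farBestQ, optMinQ, hF, hG, Option.some.injEq] at h; rw [← h]; exact min_le_right _ _

-- Sanity instance (input certificate): at the policy cut `κ = 28` of the far type `(4,3,1)` the best cap is the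
-- reference-table one; at `κ = 24` of `(6)` it is the shell-class-table one.
example : farBestQ 28 [1, 3, 4] = farRQ 28 [1, 3, 4] := by decide +kernel

example : farBestQ 24 [6] = farFQ 24 [6] := by decide +kernel

end WPatD10Best

end Literature.Probability.FitznerVanDerHofstad2017
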